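import Literature.AlgebraicGeometry.AbelianSchemes.AbelianSchemePolarization
import Literature.GroupTheory.FiniteAbelian.PiZModSquareChainUnique
import HarnessLib

/-!
# A polarisation has at most one type

Family `hodge`, layer `Literature/AlgebraicGeometry/AbelianSchemes`; cell hodgecm-mathlib (U-DAG brick B4, flag (d)).
★ `AbelianSchemeOver.Polarization.HasType δ` ([MumfordFogartyKirwan1994] App. 7A «`ker(λ) ≅ ∏ ℤ/δᵢℤ × ∏ μ_{δᵢ}`»,
read on `Ω`-points: `δ` is a polarisation type and at every geometric point the kernel of `λ̄` is the image of an
injective homomorphism from `(Πᵢ ℤ/δᵢ)²`).  THIS FILE: if `pol.HasType δ` and `pol.HasType δ'` and the base has a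
geometric point, then `δ = δ'` — the two injective homomorphisms have the same image `kerPointsAt s`, so
`(Πᵢ ℤ/δᵢ)² ≃ (Πᵢ ℤ/δ'ᵢ)²`, and ★ `GroupTheory.FiniteAbelian.pi_zmod_sq_chain_unique_of_range_eq`
([Hungerford1974] Thm. 2.6 (ii), uniqueness of invariant factors, squared shape) gives `δ = δ'`.
(Over an EMPTY base both `HasType δ` and `HasType δ'` hold vacuously, whence the point hypothesis.)
No definition, no named fact, no `sorry`.

## References
* [MumfordFogartyKirwan1994] D. Mumford, J. Fogarty, F. Kirwan, *Geometric Invariant Theory*, 3rd ed. (1994), App. 7A (pp. 234–235).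
* [LangeBirkenhake1992] H. Lange, Ch. Birkenhake, *Complex Abelian Varieties* (1992), §3.1 (type of a polarisation).
* [Hungerford1974] T. W. Hungerford, *Algebra*, GTM 73 (1974), Ch. II Thm. 2.6 (ii) (PDF p. 137).
-/

universe u

open CategoryTheory AlgebraicGeometry

noncomputable section

namespace Literature.AlgebraicGeometry.AbelianSchemes

namespace AbelianSchemeOver.Polarization

variable {S : Scheme.{u}} {A : AbelianSchemeOver S} {D : A.DualPair} (pol : A.Polarization D)

/-- **A polarisation has at most one type**: `pol.HasType δ → pol.HasType δ' → δ = δ'` as soon as the base has a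
geometric point `s : Spec Ω → S` (`Ω` algebraically closed). [cite: MumfordFogartyKirwan1994, App. 7A (pp. 234–235)]
[cite: Hungerford1974, Ch. II Thm. 2.6 (ii) (PDF p. 137)] -/
theorem HasType.eq_of_hasType {g : ℕ} {δ δ' : Fin g → ℕ} (h : pol.HasType δ) (h' : pol.HasType δ')
    {Ω : Type u} [Field Ω] [IsAlgClosed Ω] (s : Spec (.of Ω) ⟶ S) : δ = δ' := by
  obtain ⟨φ, hφ, hrφ⟩ := HasType.exists_mulHom pol h Ω s
  obtain ⟨φ', hφ', hrφ'⟩ := HasType.exists_mulHom pol h' Ω s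
  have hδ := HasType.isPolarizationType pol h
  have hδ' := HasType.isPolarizationType pol h'
  exact Literature.GroupTheory.FiniteAbelian.pi_zmod_sq_chain_unique_of_range_eq
    hδ.1 hδ'.1 hδ.2 hδ'.2 hφ hφ' (hrφ.trans hrφ'.symm)

/-- The same with the point packaged as `Nonempty` (the shape «the base has a geometric point»).
[cite: MumfordFogartyKirwan1994, App. 7A (pp. 234–235)] -/
theorem HasType.eq_of_hasType_of_nonempty {g : ℕ} {δ δ' : Fin g → ℕ} (h : pol.HasType δ) (h' : pol.HasType δ')
    {Ω : Type u} [Field Ω] [IsAlgClosed Ω] (hs : Nonempty (Spec (.of Ω) ⟶ S)) : δ = δ' :=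
  hs.elim fun s ↦ HasType.eq_of_hasType pol h h' s

end AbelianSchemeOver.Polarization

end Literature.AlgebraicGeometry.AbelianSchemes

end
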